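import Literature.AlgebraicGeometry.Resolution.WeightedCentreStep
import Literature.AlgebraicGeometry.Resolution.WeightedCentreVertexPreparation
import Literature.AlgebraicGeometry.Resolution.WeightedBlowupFaceRestriction
import Literature.AlgebraicGeometry.Resolution.HironakaDirectrixVars
import Mathlib.Algebra.CharP.Lemmas
import Mathlib.Algebra.MvPolynomial.PDeriv
import Mathlib.FieldTheory.Finite.Basic
import HarnessLib

/-!
# The umbrella `X_i^p + X_j^m X_l`: its maximal centre, and the one point of the weighted step where it reproduces itself (`pub-rosobs`, carver-g39)

A row-free, all-characteristic companion of `KangarooAtlasCertWeightedStepLoops` (carver-g38, five `𝔽₂` rows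
checked by `decide`) inside the ALGEBRAIC model of the weighted-centre invariant of
`WeightedCentreInvariantSet` / `WeightedCentreStep`: the invariant set `W(f) = admissibleInvariants f`
(all admissible centres, over ALL regular systems of parameters `Ψ`, [cite: AbramovichTemkinWlodarczyk2024,
§5.1 (invariants (a₁ ≤ … ≤ a_k) of J-admissible centres, truncations larger)]), its maximum `IsMaxInv`, and the
step germ `stepGerm w ℓ b f` at a point `b` of the exceptional divisor of the cobordant blow-up `B₊`
[cite: AbramovichQuekSchober2025, Def. 4.5 (proper transform on B) and Construction 4.2].

The shape is the generalised Whitney umbrella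
`umbrella k i j l p m = X_i ^ p + X_j ^ m * X_l` in `MvPolynomial (Fin N) k`, `i, j, l` distinct, all other
variables spectators (for `p = 2`, `m = 2`, `k = 𝔽₂` this is Włodarczyk's umbrella `x² + y²z`
[cite: Temkin2025, §1.2.2 warning (1) (multiorder (2,3,3) at each closed point of the z-axis)]; over `ℂ` and
`m = 2` it is the Whitney umbrella / pinch point [cite: Kollar2007, Example 3.6.1]).

## What is certified (sorry-free, every characteristic unless said otherwise)

* `isMaxInv_umbrella`: for `2 ≤ p ≤ m` and `p ∤ m + 1` the invariant of the umbrella is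
  `max W(umbrella) = (p, m+1, m+1)` — the coordinate centre `(X_i^p, X_j^{m+1}, X_l^{m+1})` is maximal among ALL
  admissible centres in ALL regular coordinate systems.  Mechanism: `[p]` is a prefix (directrix of the initial
  form `X_i^p`, `τ = 1`, [cite: CossartJannsenSaito2020, Thm 8.16 / Def. 8.2 (δ-prepared vertex)]); Hironaka's
  `δ(f; X_i) = (m+1)/p` is not an integer, so the polyhedron is `δ`-prepared for free and the `δ`-initial form is
  the whole umbrella, whose directrix has `τ = 3`; the vertex theorems
  `succ_card_le_countP_exps_of_isDeltaPrepared` / `hironakaTau_deltaInitial_le_of_forall_natCast_ne` of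
  `WeightedCentreVertexPreparation` then force at least three entries `≤ m+1`.
* `stepGerm_umbrella`: with the reduced weights `w = (m+1 on X_i; p on X_j, X_l; 0 elsewhere)`, `ℓ = p(m+1)`,
  the umbrella is weighted-homogeneous of weight `ℓ`, so its transform on `B` is the umbrella with the exceptional
  variable prepended, and the step germ at the point `b` is `(X_i' + b_i)^p + (X_j' + b_j)^m (X_l' + b_l)`.
* `stepStalls_umbrella` (characteristic `p`, `m = p·e`, `e ≥ 1`): at every point `b` of the exceptional divisor
  with `b_i = b_j = 0` and `b_l` a `p`-th power (every point when `k` is perfect, e.g. `stepStalls_umbrella_zmod`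
  over `𝔽_p`) the new germ is the umbrella again in the regular system of parameters
  `X_i' ↦ X_i' + c X_j'^e` (`c^p = b_l`), hence `max W` of the new germ is `(p, pe+1, pe+1)` again:
  the step REPRODUCES ITS VALUE (`StepStalls`) [cite: AbramovichTemkinWlodarczyk2024, Thm 5.3.1 (in
  characteristic zero the invariant drops — here it does not)].
* `stepDrops_umbrella_of_ne`: at every point with `b_i ≠ 0` or `b_j ≠ 0` the order of the new germ is `≤ 1 < p`,
  so every invariant of the new germ is below `(p, …)` (`StepDrops`, via `stepDrops_of_monomialOrd_lt` and
  [cite: AbramovichTemkinWlodarczyk2024, Lemma 5.2.7 (ν(F) ≤ ν(∂F) + w)]).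
  Together (`step_umbrella_dichotomy_zmod`): over `𝔽_p` the exceptional divisor of the step of `v^p + w^{pe} u`
  carries exactly one torus class of rational points at which the value is kept, and it is kept with the SAME shape.

## What is NOT certified here

* nothing about non-closed / non-rational points of the exceptional divisor, nor about points with `b_l ∉ k^p`;
* the case `p ∣ m + 1` of the maximality (e.g. `v² + w³u`, `δ = 2` integral; the census shapes `m = pe` never
  hit it), and `m < p`;
* any resolution statement: a reproduced value is an OBSTRUCTION to the characteristic-free termination argument,
  not progress on resolution in characteristic `p`.

Value type: typed theorem in the `W(f)` model (instrument) — NOT a resolution theorem, NOT summit progress.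
-/

noncomputable section

open MvPolynomial

namespace Literature.AlgebraicGeometry.Resolution

namespace WeightedBlowup

/-! ## §0 The elementary automorphism `X_a ↦ X_a + c · X_b ^ e` -/

section Shear

variable {σ : Type*} [DecidableEq σ] {K : Type*} [CommRing K]

/-- The substitution `X_a ↦ X_a + c X_b^e`, all other variables fixed, as a `K`-algebra map. (derived here)
[cite: AbramovichTemkinWlodarczyk2024, §5.1 (invariants are taken over all regular systems of parameters)] -/
def addMonomialShearHom (a b : σ) (c : K) (e : ℕ) : MvPolynomial σ K →ₐ[K] MvPolynomial σ K :=
  aeval fun x => if x = a then X a + C c * X b ^ e else X x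

/-- The substitution on a variable (plumbing). [folklore] -/
private theorem addMonomialShearHom_X (a b : σ) (c : K) (e : ℕ) (x : σ) :
    addMonomialShearHom a b c e (X x) = if x = a then X a + C c * X b ^ e else X x := by
  simp [addMonomialShearHom]

/-- The substitutions with `c` and `-c` are inverse to each other (plumbing). [folklore] -/
private theorem addMonomialShearHom_comp_neg {a b : σ} (hab : b ≠ a) (c : K) (e : ℕ) :
    (addMonomialShearHom a b c e).comp (addMonomialShearHom a b (-c) e) = AlgHom.id K _ := by
  refine MvPolynomial.algHom_ext fun x => ?_
  rw [AlgHom.comp_apply, AlgHom.id_apply, addMonomialShearHom_X]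
  by_cases hx : x = a
  · subst hx
    rw [if_pos rfl, map_add, map_mul, map_pow, addMonomialShearHom_X, if_pos rfl, addMonomialShearHom_X,
      if_neg hab, algHom_C, algebraMap_eq, map_neg]
    ring
  · rw [if_neg hx, addMonomialShearHom_X, if_neg hx]

/-- The elementary automorphism `X_a ↦ X_a + c X_b^e` (`b ≠ a`) of the polynomial ring, with inverse
`X_a ↦ X_a − c X_b^e`: a change of the regular system of parameters at the origin. (derived here)
[cite: AbramovichTemkinWlodarczyk2024, §5.1 (invariants are taken over all regular systems of parameters)] -/
def addMonomialShear (a b : σ) (hab : b ≠ a) (c : K) (e : ℕ) : MvPolynomial σ K ≃ₐ[K] MvPolynomial σ K :=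
  AlgEquiv.ofAlgHom (addMonomialShearHom a b c e) (addMonomialShearHom a b (-c) e)
    (addMonomialShearHom_comp_neg hab c e)
    (by simpa using addMonomialShearHom_comp_neg hab (-c) e)

/-- The shear on its moving variable: `X_a ↦ X_a + c X_b^e`. (derived here)
[cite: AbramovichTemkinWlodarczyk2024, §5.1 (regular systems of parameters)] -/
theorem addMonomialShear_X_self (a b : σ) (hab : b ≠ a) (c : K) (e : ℕ) :
    addMonomialShear a b hab c e (X a) = X a + C c * X b ^ e := by
  change addMonomialShearHom a b c e (X a) = _
  rw [addMonomialShearHom_X, if_pos rfl]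

/-- The shear fixes every other variable. (derived here)
[cite: AbramovichTemkinWlodarczyk2024, §5.1 (regular systems of parameters)] -/
theorem addMonomialShear_X_of_ne (a b : σ) (hab : b ≠ a) (c : K) (e : ℕ) {x : σ} (hx : x ≠ a) :
    addMonomialShear a b hab c e (X x) = X x := by
  change addMonomialShearHom a b c e (X x) = _
  rw [addMonomialShearHom_X, if_neg hx]

/-- The shear fixes the origin when `e ≠ 0`. (derived here)
[cite: AbramovichTemkinWlodarczyk2024, §5.1] -/
theorem constantCoeff_addMonomialShear_X (a b : σ) (hab : b ≠ a) (c : K) {e : ℕ} (he : e ≠ 0) (x : σ) :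
    constantCoeff (addMonomialShear a b hab c e (X x)) = 0 := by
  by_cases hx : x = a
  · subst hx
    rw [addMonomialShear_X_self]
    simp [constantCoeff_X, he]
  · rw [addMonomialShear_X_of_ne a b hab c e hx, constantCoeff_X]

end Shear

variable {k : Type*} [Field k] {N : ℕ}

/-! ## §1 The umbrella and its two monomials -/

section Umbrella

variable (k) in
/-- The generalised Whitney umbrella `X_i^p + X_j^m X_l` (all other variables of `Fin N` are spectators).
[cite: Temkin2025, §1.2.2 warning (1) (x² + y²z)] [cite: Kollar2007, Example 3.6.1 (pinch point)] -/
def umbrella (i j l : Fin N) (p m : ℕ) : MvPolynomial (Fin N) k := X i ^ p + X j ^ m * X l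

variable {i j l : Fin N} {p m : ℕ}

/-- The exponent of the monomial `X_j^m X_l` (plumbing def). [folklore] -/
def umbExp (j l : Fin N) (m : ℕ) : Fin N →₀ ℕ := Finsupp.single j m + Finsupp.single l 1

/-- Evaluation of the umbrella (plumbing). [folklore] -/
private theorem aeval_umbrella {A : Type*} [CommSemiring A] [Algebra k A] (v : Fin N → A) :
    aeval v (umbrella k i j l p m) = v i ^ p + v j ^ m * v l := by
  simp [umbrella]

/-- The umbrella as a sum of two monomials (plumbing). [folklore] -/
private theorem umbrella_eq (i j l : Fin N) (p m : ℕ) :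
    umbrella k i j l p m = monomial (Finsupp.single i p) 1 + monomial (umbExp j l m) 1 := by
  rw [umbrella, umbExp, X_pow_eq_monomial, X_pow_eq_monomial, ← pow_one (X l : MvPolynomial (Fin N) k),
    X_pow_eq_monomial, monomial_mul, mul_one]

/-- Exponent bookkeeping (plumbing). [folklore] -/
private theorem umbExp_apply_l (hjl : j ≠ l) : umbExp j l m l = 1 := by
  simp [umbExp, hjl]

/-- Exponent bookkeeping (plumbing). [folklore] -/
private theorem umbExp_apply_j (hjl : j ≠ l) : umbExp j l m j = m := by
  simp [umbExp, hjl.symm]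

/-- Exponent bookkeeping (plumbing). [folklore] -/
private theorem umbExp_apply_of_ne {x : Fin N} (hxj : x ≠ j) (hxl : x ≠ l) : umbExp j l m x = 0 := by
  simp [umbExp, hxj.symm, hxl.symm]

/-- The two exponents of the umbrella are distinct (plumbing). [folklore] -/
private theorem single_ne_umbExp (hil : i ≠ l) (hjl : j ≠ l) : Finsupp.single i p ≠ umbExp j l m := by
  intro h
  have := congrArg (fun d => d l) h
  simp only [Finsupp.single_apply, if_neg hil, umbExp_apply_l hjl] at this
  exact zero_ne_one this

/-- Degree of the second exponent (plumbing). [folklore] -/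
private theorem degree_umbExp (j l : Fin N) (m : ℕ) : (umbExp j l m).degree = m + 1 := by
  rw [umbExp, map_add, Finsupp.degree_single, Finsupp.degree_single]

/-- Support of the umbrella (plumbing). [folklore] -/
private theorem support_umbrella_subset :
    (umbrella k i j l p m).support ⊆ {Finsupp.single i p, umbExp j l m} := by
  rw [umbrella_eq]
  refine (support_add).trans (Finset.union_subset ?_ ?_)
  · exact (support_monomial_subset).trans (by simp)
  · exact (support_monomial_subset).trans (by simp)

/-- Support of the umbrella (plumbing). [folklore] -/
private theorem mem_pair_of_mem_support_umbrella {d : Fin N →₀ ℕ} (hd : d ∈ (umbrella k i j l p m).support) :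
    d = Finsupp.single i p ∨ d = umbExp j l m := by
  simpa [Finset.mem_insert, Finset.mem_singleton] using support_umbrella_subset hd

/-- Coefficients of the umbrella (plumbing). [folklore] -/
private theorem coeff_single_umbrella (hil : i ≠ l) (hjl : j ≠ l) :
    coeff (Finsupp.single i p) (umbrella k i j l p m) = 1 := by
  rw [umbrella_eq, coeff_add, coeff_monomial, coeff_monomial, if_pos rfl,
    if_neg (single_ne_umbExp hil hjl).symm, add_zero]

/-- Coefficients of the umbrella (plumbing). [folklore] -/
private theorem coeff_umbExp_umbrella (hil : i ≠ l) (hjl : j ≠ l) :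
    coeff (umbExp j l m) (umbrella k i j l p m) = 1 := by
  rw [umbrella_eq, coeff_add, coeff_monomial, coeff_monomial, if_neg (single_ne_umbExp hil hjl), if_pos rfl,
    zero_add]

/-- Support of the umbrella (plumbing). [folklore] -/
private theorem single_mem_support_umbrella (hil : i ≠ l) (hjl : j ≠ l) :
    Finsupp.single i p ∈ (umbrella k i j l p m).support := by
  rw [mem_support_iff, coeff_single_umbrella hil hjl]; exact one_ne_zero

/-- Support of the umbrella (plumbing). [folklore] -/
private theorem umbExp_mem_support_umbrella (hil : i ≠ l) (hjl : j ≠ l) :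
    umbExp j l m ∈ (umbrella k i j l p m).support := by
  rw [mem_support_iff, coeff_umbExp_umbrella hil hjl]; exact one_ne_zero

/-- Variables of the umbrella (plumbing). [folklore] -/
private theorem vars_umbrella_subset : (umbrella k i j l p m).vars ⊆ {i, j, l} := by
  rw [umbrella]
  refine (vars_add_subset _ _).trans (Finset.union_subset ?_ ?_)
  · refine (vars_pow _ _).trans ?_
    rw [vars_X]; simp
  · refine (vars_mul _ _).trans (Finset.union_subset ((vars_pow _ _).trans ?_) ?_)
    · rw [vars_X]; simp
    · rw [vars_X]; simp

/-- The order of the umbrella is `p` (when `p ≤ m + 1`). [cite: AbramovichTemkinWlodarczyk2024, §5.1 (a₁ = ord)] -/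
theorem monomialOrd_umbrella (hil : i ≠ l) (hjl : j ≠ l) (hpm : p ≤ m + 1) :
    monomialOrd (fun _ => 1) (umbrella k i j l p m) = p := by
  apply le_antisymm
  · refine (monomialOrd_le_weight (fun _ => 1) (single_mem_support_umbrella hil hjl)).trans ?_
    rw [← Finsupp.degree_eq_weight_one, Finsupp.degree_single]
  · rw [le_monomialOrd_one_iff]
    intro d hd
    rcases mem_pair_of_mem_support_umbrella hd with rfl | rfl
    · rw [Finsupp.degree_single]
    · rw [degree_umbExp]; exact_mod_cast hpm

/-- The initial form of the umbrella is `X_i^p` (when `p ≠ m + 1`). [cite: CossartJannsenSaito2020, Def. 8.2] -/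
theorem homogeneousComponent_umbrella (hpm : p ≠ m + 1) :
    homogeneousComponent p (umbrella k i j l p m) = X i ^ p := by
  have h1 : (X i ^ p : MvPolynomial (Fin N) k).IsHomogeneous p := isHomogeneous_X_pow i p
  have h2 : (X j ^ m * X l : MvPolynomial (Fin N) k).IsHomogeneous (m + 1) :=
    (isHomogeneous_X_pow j m).mul (isHomogeneous_X k l)
  rw [umbrella, map_add, homogeneousComponent_of_mem h1, homogeneousComponent_of_mem h2, if_pos rfl,
    if_neg hpm, add_zero]

end Umbrella

/-! ## §2 Directrices: `τ(X_i^p) = 1`, `τ(umbrella) = 3` -/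

section Tau

variable {i j l : Fin N} {p m : ℕ}

/-- A vector of the invariance space of `{F}` is a direction of translation invariance of `F` at every point:
`F(y + t w) = F(y)`. (derived here) [cite: CossartJannsenSaito2020, Def. 1.26 / Lemma 1.27 (directrix as the
space of translations leaving the form invariant)] -/
theorem aeval_eq_of_mem_invarianceSpace {F : MvPolynomial (Fin N) k} {w : Fin N → k}
    (hw : w ∈ invarianceSpace k {F}) (y : Fin N → k) (t : k) :
    aeval (fun x => y x + w x * t) F = aeval y F := by
  have h := (mem_invarianceSpace_iff k).1 hw F (Set.mem_singleton F)
  have := congrArg (aeval fun o : Option (Fin N) => o.elim t y) h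
  rw [translate, ← AlgHom.comp_apply, comp_aeval, aeval_rename, aeval_rename] at this
  have e1 : ((fun o : Option (Fin N) =>
      (aeval fun o : Option (Fin N) => o.elim t y) (o.elim (X none) fun x => X (some x) + C (w x) * X none)) ∘
        some) = fun x => y x + w x * t := by
    funext x
    simp
  have e2 : ((fun o : Option (Fin N) => o.elim t y) ∘ some) = y := by
    funext x
    simp
  rw [e1, e2] at this
  exact this

/-- If every invariance direction of `{F}` vanishes on a set `s` of variables containing `vars F`, then
`τ(F) = #s`. (derived here) [cite: CossartJannsenSaito2020, Def. 1.26 (τ = codimension of the directrix)] -/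
theorem hironakaTau_singleton_eq_card {F : MvPolynomial (Fin N) k} {s : Finset (Fin N)}
    (hvars : F.vars ⊆ s) (hW : ∀ w ∈ invarianceSpace k {F}, ∀ x ∈ s, w x = 0) :
    hironakaTau k {F} = s.card := by
  have hWeq : invarianceSpace k {F} = vanishingOn k s := by
    apply le_antisymm
    · intro w hw
      exact (mem_vanishingOn_iff k).2 (hW w hw)
    · intro w hw
      rw [mem_vanishingOn_iff] at hw
      refine (mem_invarianceSpace_iff k).2 fun G hG => ?_
      rw [Set.mem_singleton_iff] at hG
      subst hG
      exact translate_rename_eq_of_forall_vars k w G fun x hx => hw x (hvars hx)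
  have h1 := hironakaTau_add_finrank_invarianceSpace k ({F} : Set (MvPolynomial (Fin N) k))
  have h2 := finrank_vanishingOn_add_card k s
  rw [hWeq] at h1
  omega

/-- `τ(X_i^p) = 1` (`p ≠ 0`, any characteristic). [cite: CossartJannsenSaito2020, Def. 1.26] -/
theorem hironakaTau_X_pow (i : Fin N) (hp : p ≠ 0) :
    hironakaTau k {(X i ^ p : MvPolynomial (Fin N) k)} = 1 := by
  rw [← Finset.card_singleton i]
  refine hironakaTau_singleton_eq_card ((vars_pow _ _).trans (by rw [vars_X])) fun w hw x hx => ?_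
  rw [Finset.mem_singleton] at hx
  subst hx
  have h0 := aeval_eq_of_mem_invarianceSpace hw (fun _ => (0 : k)) 1
  simp only [map_pow, aeval_X, zero_add, mul_one, zero_pow hp] at h0
  exact (pow_eq_zero_iff hp).1 h0

/-- `τ(X_i^p + X_j^m X_l) = 3` for distinct `i, j, l`, `p, m ≠ 0`, in EVERY characteristic (although in
characteristic `p ∣ m` the partial derivatives only span a line): the directrix is computed from translation
invariance at the points `0`, `e_l`, `e_j`. (derived here) [cite: CossartJannsenSaito2020, Def. 1.26] -/
theorem hironakaTau_umbrella (hij : i ≠ j) (hil : i ≠ l) (hjl : j ≠ l) (hp : p ≠ 0) (hm : m ≠ 0) :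
    hironakaTau k {umbrella k i j l p m} = 3 := by
  have hcard : ({i, j, l} : Finset (Fin N)).card = 3 := by
    rw [Finset.card_insert_of_notMem (by simp [hij, hil]), Finset.card_insert_of_notMem (by simp [hjl]),
      Finset.card_singleton]
  rw [← hcard]
  refine hironakaTau_singleton_eq_card vars_umbrella_subset fun w hw x hx => ?_
  have h0 := aeval_eq_of_mem_invarianceSpace hw (fun _ => (0 : k)) 1
  have h1 := aeval_eq_of_mem_invarianceSpace hw (Pi.single l 1) 1
  have h2 := aeval_eq_of_mem_invarianceSpace hw (Pi.single j 1) 1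
  simp only [aeval_umbrella, zero_add, mul_one, zero_pow hp, zero_pow hm, zero_mul, add_zero] at h0
  simp only [aeval_umbrella, Pi.single_eq_same, Pi.single_eq_of_ne hil, Pi.single_eq_of_ne hjl, zero_add,
    mul_one, zero_pow hp, zero_pow hm, add_zero] at h1
  simp only [aeval_umbrella, Pi.single_eq_same, Pi.single_eq_of_ne hij, Pi.single_eq_of_ne hjl.symm, zero_add,
    mul_one, zero_pow hp, one_pow, mul_zero, add_zero] at h2
  have hj0 : w j = 0 := by
    have : w j ^ m = 0 := by linear_combination h1 - h0
    exact (pow_eq_zero_iff hm).1 this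
  have hi0 : w i = 0 := by
    rw [hj0, zero_pow hm, zero_mul, add_zero] at h0
    exact (pow_eq_zero_iff hp).1 h0
  have hl0 : w l = 0 := by
    simp only [hi0, hj0, zero_pow hp, add_zero, one_pow, one_mul, zero_add] at h2
    exact h2
  simp only [Finset.mem_insert, Finset.mem_singleton] at hx
  rcases hx with rfl | rfl | rfl
  exacts [hi0, hj0, hl0]

end Tau

/-! ## §3 The coordinate centre `(X_i^p, X_j^{m+1}, X_l^{m+1})` is admissible: `(p, m+1, m+1) ∈ W` -/

section Centre

variable {i j l : Fin N} {p m : ℕ}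

/-- The cocharacter of the coordinate centre `(X_i^p, X_j^{m+1}, X_l^{m+1})`: `1/p` on `X_i`, `1/(m+1)` on
`X_j, X_l`, `0` on the spectators. [cite: AbramovichTemkinWlodarczyk2024, §5.1] -/
def umbrellaWeights (i j l : Fin N) (p m : ℕ) : Fin N → ℚ := fun x =>
  if x = i then (p : ℚ)⁻¹ else if x = j ∨ x = l then (((m + 1 : ℕ) : ℚ))⁻¹ else 0

/-- Values of the umbrella cocharacter (plumbing). [folklore] -/
private theorem umbrellaWeights_i : umbrellaWeights i j l p m i = (p : ℚ)⁻¹ := by simp [umbrellaWeights]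

/-- Values of the umbrella cocharacter (plumbing). [folklore] -/
private theorem umbrellaWeights_j (hij : i ≠ j) : umbrellaWeights i j l p m j = (((m + 1 : ℕ) : ℚ))⁻¹ := by
  simp [umbrellaWeights, hij.symm]

/-- Values of the umbrella cocharacter (plumbing). [folklore] -/
private theorem umbrellaWeights_l (hil : i ≠ l) : umbrellaWeights i j l p m l = (((m + 1 : ℕ) : ℚ))⁻¹ := by
  simp [umbrellaWeights, hil.symm]

/-- Values of the umbrella cocharacter (plumbing). [folklore] -/
private theorem umbrellaWeights_of_ne {x : Fin N} (h1 : x ≠ i) (h2 : x ≠ j) (h3 : x ≠ l) :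
    umbrellaWeights i j l p m x = 0 := by
  simp [umbrellaWeights, h1, h2, h3]

/-- `exps` of the umbrella cocharacter is `[p, m+1, m+1]`. (derived here)
[cite: AbramovichTemkinWlodarczyk2024, §5.1 (invariant (a₁,…,a_k) of the centre)] -/
theorem exps_umbrellaWeights (hij : i ≠ j) (hil : i ≠ l) (hjl : j ≠ l) (hp : 0 < p) (hpm : p ≤ m + 1) :
    exps (umbrellaWeights i j l p m) = [(p : ℚ), ((m + 1 : ℕ) : ℚ), ((m + 1 : ℕ) : ℚ)] := by
  classical
  have hpq : (p : ℚ) ≠ 0 := by exact_mod_cast hp.ne'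
  have hM : (((m + 1 : ℕ) : ℚ)) ≠ 0 := by positivity
  have hfilter : (Finset.univ.filter fun x => umbrellaWeights i j l p m x ≠ 0) = {i, j, l} := by
    ext x
    simp only [Finset.mem_filter, Finset.mem_univ, true_and, Finset.mem_insert, Finset.mem_singleton]
    constructor
    · intro hx
      by_contra hne
      push Not at hne
      exact hx (umbrellaWeights_of_ne hne.1 hne.2.1 hne.2.2)
    · rintro (rfl | rfl | rfl)
      · rw [umbrellaWeights_i]; exact inv_ne_zero hpq
      · rw [umbrellaWeights_j hij]; exact inv_ne_zero hM
      · rw [umbrellaWeights_l hil]; exact inv_ne_zero hM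
  have h3 : (({i, j, l} : Finset (Fin N)).toList).Perm [i, j, l] :=
    (Finset.toList_insert (by simp [hij, hil])).trans
      (List.Perm.cons _ ((Finset.toList_insert (by simp [hjl])).trans
        (List.Perm.of_eq (by rw [Finset.toList_singleton]))))
  have hperm : (exps (umbrellaWeights i j l p m)).Perm [(p : ℚ), ((m + 1 : ℕ) : ℚ), ((m + 1 : ℕ) : ℚ)] := by
    unfold exps
    refine (List.perm_insertionSort _ _).trans ?_
    rw [hfilter]
    refine (h3.map _).trans (List.Perm.of_eq ?_)
    simp only [List.map_cons, List.map_nil, umbrellaWeights_i, umbrellaWeights_j hij, umbrellaWeights_l hil,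
      inv_inv]
  have hsorted : [(p : ℚ), ((m + 1 : ℕ) : ℚ), ((m + 1 : ℕ) : ℚ)].Pairwise (· ≤ ·) := by
    have : (p : ℚ) ≤ (m : ℚ) + 1 := by exact_mod_cast hpm
    simp [this]
  exact hperm.eq_of_sortedLE (exps_sorted _).sortedLE hsorted.sortedLE

/-- Monomial valuation of a pure power (plumbing). [folklore] -/
private theorem monomialValuation_single (γ : Fin N → ℚ) (x : Fin N) (n : ℕ) :
    monomialValuation γ (Finsupp.single x n) = (n : ℚ) * γ x := by
  rw [monomialValuation, Finsupp.sum_single_index (by simp)]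

/-- Monomial valuation of the second exponent (plumbing). [folklore] -/
private theorem monomialValuation_umbExp (γ : Fin N → ℚ) (j l : Fin N) (m : ℕ) :
    monomialValuation γ (umbExp j l m) = (m : ℚ) * γ j + γ l := by
  rw [umbExp, monomialValuation, Finsupp.sum_add_index' (by simp) (by intros; simp [add_mul]),
    Finsupp.sum_single_index (by simp), Finsupp.sum_single_index (by simp)]
  simp

/-- The coordinate centre `(X_i^p, X_j^{m+1}, X_l^{m+1})` is admissible for the umbrella (`Ψ = id`).
(derived here) [cite: AbramovichTemkinWlodarczyk2024, Lemma 5.2.10 (coordinate dependence)] -/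
theorem isCentreFor_umbrellaWeights (hij : i ≠ j) (hil : i ≠ l) (hp : 0 < p) :
    IsCentreFor (umbrella k i j l p m) AlgEquiv.refl (umbrellaWeights i j l p m) := by
  have hpq : (0 : ℚ) < p := by exact_mod_cast hp
  have hM : (0 : ℚ) < ((m + 1 : ℕ) : ℚ) := by positivity
  refine ⟨fun x => constantCoeff_X k x, fun x => ?_, fun d hd => ?_⟩
  · unfold umbrellaWeights
    split_ifs
    · positivity
    · positivity
    · exact le_rfl
  · change d ∈ (umbrella k i j l p m).support at hd
    rcases mem_pair_of_mem_support_umbrella hd with rfl | rfl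
    · rw [monomialValuation_single, umbrellaWeights_i, mul_inv_cancel₀ hpq.ne']
    · rw [monomialValuation_umbExp, umbrellaWeights_j hij, umbrellaWeights_l hil, ← add_one_mul]
      have : ((m : ℚ) + 1) = ((m + 1 : ℕ) : ℚ) := by push_cast; ring
      rw [this, mul_inv_cancel₀ hM.ne']

/-- `(p, m+1, m+1) ∈ W(umbrella)`. (derived here) [cite: AbramovichTemkinWlodarczyk2024, §5.1] -/
theorem umbrella_inv_mem (hij : i ≠ j) (hil : i ≠ l) (hjl : j ≠ l) (hp : 0 < p) (hpm : p ≤ m + 1) :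
    [(p : ℚ), ((m + 1 : ℕ) : ℚ), ((m + 1 : ℕ) : ℚ)] ∈ admissibleInvariants (umbrella k i j l p m) := by
  rw [← exps_umbrellaWeights hij hil hjl hp hpm]
  exact exps_mem_admissibleInvariants (isCentreFor_umbrellaWeights hij hil hp)

end Centre

/-! ## §4 Hironaka's `δ` with respect to `X_i`: `δ = (m+1)/p`, vacuous `δ`-preparedness, `δ`-initial form -/

section Delta

variable {i j l : Fin N} {p m : ℕ}

/-- For a single distinguished variable `X_i` the block degree `|A|` of an exponent is its `i`-th entry.
(derived here) [cite: CossartJannsenSaito2020, Def. 8.2 (exponents (A, B) of Δ(f; u))] -/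
theorem blockDeg_singleton (i : Fin N) (d : Fin N →₀ ℕ) : blockDeg {i} d = d i := by
  classical
  unfold blockDeg
  rw [Finset.sum_filter]
  simp only [Finset.mem_singleton]
  rw [Finset.sum_ite_eq']
  split_ifs with h
  · rfl
  · exact (Finsupp.notMem_support_iff.1 h).symm

/-- For a single distinguished variable `X_i` the co-degree `|B|` of an exponent is the total degree minus
its `i`-th entry. (derived here) [cite: CossartJannsenSaito2020, Def. 8.2 (exponents (A, B) of Δ(f; u))] -/
theorem coDeg_singleton (i : Fin N) (d : Fin N →₀ ℕ) : coDeg {i} d = d.degree - d i := by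
  have := blockDeg_add_coDeg {i} d
  rw [blockDeg_singleton] at this
  omega

/-- Block degrees of the umbrella exponents (plumbing). [folklore] -/
private theorem blockDeg_singleton_umbExp (hij : i ≠ j) (hil : i ≠ l) : blockDeg {i} (umbExp j l m) = 0 := by
  rw [blockDeg_singleton, umbExp_apply_of_ne hij hil]

/-- Block degrees of the umbrella exponents (plumbing). [folklore] -/
private theorem coDeg_singleton_umbExp (hij : i ≠ j) (hil : i ≠ l) : coDeg {i} (umbExp j l m) = m + 1 := by
  rw [coDeg_singleton, degree_umbExp, umbExp_apply_of_ne hij hil, Nat.sub_zero]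

/-- Block degrees of the umbrella exponents (plumbing). [folklore] -/
private theorem blockDeg_singleton_single : blockDeg {i} (Finsupp.single i p) = p := by
  rw [blockDeg_singleton, Finsupp.single_eq_same]

/-- Block degrees of the umbrella exponents (plumbing). [folklore] -/
private theorem coDeg_singleton_single : coDeg {i} (Finsupp.single i p) = 0 := by
  rw [coDeg_singleton, Finsupp.degree_single, Finsupp.single_eq_same, Nat.sub_self]

/-- Hironaka's `δ(umbrella; X_i) = (m+1)/p`: the only vertex of `Δ(f; X_i)` is the projection of `X_j^m X_l`.
(derived here) [cite: CossartJannsenSaito2020, Def. 8.2 (δ(f;u))] -/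
theorem hironakaDelta_umbrella (hij : i ≠ j) (hil : i ≠ l) (hjl : j ≠ l) (hp : 0 < p) :
    hironakaDelta {i} p (umbrella k i j l p m) = ((((m + 1 : ℕ) : ℚ) / (p : ℚ) : ℚ) : WithTop ℚ) := by
  classical
  apply le_antisymm
  · unfold hironakaDelta
    refine (Finset.inf_le (Finset.mem_filter.2 ⟨umbExp_mem_support_umbrella hil hjl, ?_⟩)).trans ?_
    · rw [blockDeg_singleton_umbExp hij hil]; exact hp
    · rw [blockDeg_singleton_umbExp hij hil, coDeg_singleton_umbExp hij hil, Nat.sub_zero]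
  · rw [le_hironakaDelta_iff]
    intro d hd hb
    rcases mem_pair_of_mem_support_umbrella hd with rfl | rfl
    · rw [blockDeg_singleton_single] at hb; exact (lt_irrefl _ hb).elim
    · rw [blockDeg_singleton_umbExp hij hil, coDeg_singleton_umbExp hij hil, Nat.sub_zero]

/-- `(m+1)/p` is not a natural number when `p ∤ m+1` (plumbing). [folklore] -/
private theorem natCast_ne_umbrellaDelta (hp : 0 < p) (hndvd : ¬ p ∣ m + 1) (q : ℕ) :
    (q : ℚ) ≠ ((m + 1 : ℕ) : ℚ) / (p : ℚ) := by
  intro hq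
  have hp' : (p : ℚ) ≠ 0 := by exact_mod_cast hp.ne'
  rw [eq_div_iff hp'] at hq
  have h2 : q * p = m + 1 := by exact_mod_cast hq
  exact hndvd (Dvd.intro_left _ h2)

/-- When `p ∤ m + 1`, `δ` is not an integer, so no vertex is solvable: the umbrella is `δ`-prepared with
respect to `X_i` for free. (derived here) [cite: CossartJannsenSaito2020, Thm 8.16 (solvable vertices have
integral coordinates)] -/
theorem isDeltaPrepared_umbrella (hij : i ≠ j) (hil : i ≠ l) (hjl : j ≠ l) (hp : 0 < p)
    (hndvd : ¬ p ∣ m + 1) : IsDeltaPrepared {i} p (umbrella k i j l p m) := by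
  intro v _ hv
  exfalso
  rw [hironakaDelta_umbrella hij hil hjl hp, WithTop.coe_eq_coe] at hv
  exact natCast_ne_umbrellaDelta hp hndvd v.degree hv

/-- A polynomial all of whose monomials lie on the `δ`-face is its own `δ`-initial form. (derived here)
[cite: CossartJannsenSaito2020, Def. 8.2 (in_δ)] -/
theorem deltaInitial_eq_self {S : Finset (Fin N)} {ν : ℕ} {δ : ℚ} {f : MvPolynomial (Fin N) k}
    (h : ∀ d ∈ f.support, blockDeg S d ≤ ν ∧ (coDeg S d : ℚ) = δ * ((ν - blockDeg S d : ℕ) : ℚ)) :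
    deltaInitial S ν δ f = f := by
  classical
  unfold deltaInitial
  rw [Finset.filter_true_of_mem h]
  exact f.as_sum.symm

/-- The `δ`-initial form of the umbrella with respect to `X_i` is the whole umbrella. (derived here)
[cite: CossartJannsenSaito2020, Def. 8.2 (in_δ)] -/
theorem deltaInitial_umbrella (hij : i ≠ j) (hil : i ≠ l) (hp : 0 < p) :
    deltaInitial {i} p (((m + 1 : ℕ) : ℚ) / (p : ℚ)) (umbrella k i j l p m) = umbrella k i j l p m := by
  have hp' : (p : ℚ) ≠ 0 := by exact_mod_cast hp.ne'
  refine deltaInitial_eq_self fun d hd => ?_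
  rcases mem_pair_of_mem_support_umbrella hd with rfl | rfl
  · rw [blockDeg_singleton_single, coDeg_singleton_single, Nat.sub_self]
    simp
  · rw [blockDeg_singleton_umbExp hij hil, coDeg_singleton_umbExp hij hil, Nat.sub_zero,
      div_mul_cancel₀ _ hp']
    exact ⟨Nat.zero_le _, rfl⟩

end Delta

/-! ## §5 Maximality: `max W(X_i^p + X_j^m X_l) = (p, m+1, m+1)` -/

section Max

variable {i j l : Fin N} {p m : ℕ}

/-- Every non-zero weight contributes its inverse to `exps` (plumbing). [folklore] -/
private theorem inv_mem_exps_of_ne_zero {γ : Fin N → ℚ} {x : Fin N} (hx : γ x ≠ 0) : (γ x)⁻¹ ∈ exps γ := by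
  classical
  unfold exps
  rw [List.mem_insertionSort, List.mem_map]
  exact ⟨x, Finset.mem_toList.2 (Finset.mem_filter.2 ⟨Finset.mem_univ _, hx⟩), rfl⟩

/-- `exps` is invariant under permutations of the variables. (derived here)
[cite: AbramovichTemkinWlodarczyk2024, §5.1] -/
theorem exps_comp_perm (γ : Fin N → ℚ) (π : Equiv.Perm (Fin N)) : exps (γ ∘ π) = exps γ := by
  classical
  unfold exps
  apply List.Perm.eq_of_sortedLE List.sortedLE_insertionSort List.sortedLE_insertionSort
  refine (List.perm_insertionSort _ _).trans (List.Perm.trans ?_ (List.perm_insertionSort _ _).symm)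
  have hmap : ((Finset.univ.filter fun x => γ x ≠ 0).toList).Perm
      (((Finset.univ.filter fun x => (γ ∘ π) x ≠ 0).toList).map π) := by
    apply List.perm_of_nodup_nodup_toFinset_eq (Finset.nodup_toList _)
      ((Finset.nodup_toList _).map π.injective)
    ext y
    simp only [List.mem_toFinset, Finset.mem_toList, Finset.mem_filter, Finset.mem_univ, true_and,
      List.mem_map, Function.comp_apply]
    constructor
    · intro hy
      exact ⟨π.symm y, by simpa using hy, by simp⟩
    · rintro ⟨x, hx, rfl⟩
      exact hx
  have := hmap.map fun x => (γ x)⁻¹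
  rw [List.map_map] at this
  exact this.symm

/-- The head of a sorted list is its minimum (plumbing). [folklore] -/
private theorem le_of_mem_of_pairwise {e x : ℚ} {es : List ℚ} (hs : (e :: es).Pairwise (· ≤ ·))
    (hx : x ∈ e :: es) : e ≤ x := by
  rcases List.mem_cons.1 hx with rfl | hx
  · exact le_rfl
  · exact (List.pairwise_cons.1 hs).1 x hx

/-- A sorted list with an entry `≤ θ` starts with one (plumbing). [folklore] -/
private theorem head_le_of_countP_pos {θ e : ℚ} {es : List ℚ} (hs : (e :: es).Pairwise (· ≤ ·))
    (h : 0 < (e :: es).countP fun x => decide (x ≤ θ)) : e ≤ θ := by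
  obtain ⟨x, hx, hxθ⟩ := List.countP_pos_iff.1 h
  exact (le_of_mem_of_pairwise hs hx).trans (by simpa using hxθ)

/-- Order bookkeeping for `[a, θ, θ]` (plumbing). [folklore] -/
private theorem not_lt_triple_of_snd_lt {a θ e₂ : ℚ} {rest : List ℚ} (h : e₂ < θ) :
    ¬ ATW.TruncLex.lt [a, θ, θ] (a :: e₂ :: rest) := by
  rw [ATW.TruncLex.cons_lt_cons, ATW.TruncLex.cons_lt_cons]
  rintro (h1 | ⟨-, h2 | ⟨h3, -⟩⟩)
  · exact lt_irrefl _ h1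
  · exact lt_asymm h h2
  · exact h.ne' h3

/-- Order bookkeeping for `[a, θ, θ]` (plumbing). [folklore] -/
private theorem not_lt_triple_of_third_le {a θ e₃ : ℚ} {rest : List ℚ} (h : e₃ ≤ θ) :
    ¬ ATW.TruncLex.lt [a, θ, θ] (a :: θ :: e₃ :: rest) := by
  rw [ATW.TruncLex.cons_lt_cons, ATW.TruncLex.cons_lt_cons, ATW.TruncLex.cons_lt_cons]
  rintro (h1 | ⟨-, h2 | ⟨-, h3 | ⟨-, h4⟩⟩⟩)
  · exact lt_irrefl _ h1
  · exact lt_irrefl _ h2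
  · exact not_lt.2 h h3
  · exact ATW.TruncLex.not_nil_lt _ h4

/-- Counting bookkeeping for the variables of weight `≥ 1/M` (plumbing). [folklore] -/
private theorem one_add_card_le_card_filter {γ : Fin N → ℚ} {i : Fin N} {P M : ℚ} (hP : 0 < P) (hPM : P ≤ M)
    (hM : 0 < M) (hγi : γ i = P⁻¹) :
    1 + (Finset.univ.filter fun x => x ∉ ({i} : Finset (Fin N)) ∧ γ x = M⁻¹).card ≤
      (Finset.univ.filter fun x => γ x ≠ 0 ∧ (γ x)⁻¹ ≤ M).card := by
  rw [add_comm, ← Finset.card_insert_of_notMem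
    (s := Finset.univ.filter fun x => x ∉ ({i} : Finset (Fin N)) ∧ γ x = M⁻¹) (a := i) (by simp)]
  refine Finset.card_le_card fun x hx => ?_
  rw [Finset.mem_insert] at hx
  rw [Finset.mem_filter]
  refine ⟨Finset.mem_univ _, ?_⟩
  rcases hx with rfl | hx
  · rw [hγi, inv_inv]; exact ⟨inv_ne_zero hP.ne', hPM⟩
  · rw [Finset.mem_filter] at hx
    rw [hx.2.2, inv_inv]; exact ⟨inv_ne_zero hM.ne', le_rfl⟩

/-- **`max W(X_i^p + X_j^m X_l) = (p, m+1, m+1)`** for `2 ≤ p ≤ m`, `p ∤ m + 1`, in every characteristic: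
the coordinate centre `(X_i^p, X_j^{m+1}, X_l^{m+1})` realises the invariant of the umbrella, maximised over ALL
admissible centres in ALL regular systems of parameters. (derived here, from the vertex theorems of
`WeightedCentreVertexPreparation`) [cite: AbramovichTemkinWlodarczyk2024, Thm 5.1.1 / §5.1 (inv = max over
admissible centres)] [cite: CossartJannsenSaito2020, Thm 8.16 (δ-prepared polyhedron computes the invariant)] -/
theorem isMaxInv_umbrella (hij : i ≠ j) (hil : i ≠ l) (hjl : j ≠ l) (hp : 2 ≤ p) (hpm : p ≤ m)
    (hndvd : ¬ p ∣ m + 1) :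
    IsMaxInv (admissibleInvariants (umbrella k i j l p m)) [(p : ℚ), ((m + 1 : ℕ) : ℚ), ((m + 1 : ℕ) : ℚ)] := by
  classical
  set f := umbrella k i j l p m with hf
  set M : ℚ := ((m + 1 : ℕ) : ℚ) with hM
  have hp0 : 0 < p := by omega
  have hm0 : m ≠ 0 := by omega
  have hpq : (0 : ℚ) < p := by exact_mod_cast hp0
  have hpq' : (p : ℚ) ≠ 0 := hpq.ne'
  have hpM : (p : ℚ) < M := by rw [hM]; exact_mod_cast Nat.lt_succ_of_le hpm
  have hM0 : (0 : ℚ) < M := hpq.trans hpM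
  have hpδ : (p : ℚ) * (M / p) = M := by field_simp
  -- the inputs of the vertex theorems
  have hord : monomialOrd (fun _ => 1) f = p := monomialOrd_umbrella hil hjl (by omega)
  have hin : homogeneousComponent p f = X i ^ p := homogeneousComponent_umbrella (by omega)
  have hτ : ({i} : Finset (Fin N)).card = hironakaTau k {homogeneousComponent p f} := by
    rw [hin, hironakaTau_X_pow i hp0.ne', Finset.card_singleton]
  have hFS : ∀ d ∈ (homogeneousComponent p f).support, ∀ x ∉ ({i} : Finset (Fin N)), d x = 0 := by
    intro d hd x hx
    rw [hin, X_pow_eq_monomial] at hd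
    have hd' := Finset.mem_singleton.1 (support_monomial_subset hd)
    rw [Finset.mem_singleton] at hx
    rw [hd', Finsupp.single_apply, if_neg (Ne.symm hx)]
  have hδ : hironakaDelta {i} p f = ((M / p : ℚ) : WithTop ℚ) := hironakaDelta_umbrella hij hil hjl hp0
  have hprep : IsDeltaPrepared {i} p f := isDeltaPrepared_umbrella hij hil hjl hp0 hndvd
  have hδint : ∀ q : ℕ, (q : ℚ) ≠ M / p := natCast_ne_umbrellaDelta hp0 hndvd
  have hτδ : hironakaTau k {deltaInitial {i} p (M / p) f} = 3 := by
    rw [hf, hM, deltaInitial_umbrella hij hil hp0]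
    exact hironakaTau_umbrella hij hil hjl hp0.ne' hm0
  refine ⟨umbrella_inv_mem hij hil hjl hp0 (by omega), ?_⟩
  rintro b ⟨Ψ, γ, h, rfl⟩
  have hsorted := exps_sorted γ
  have hγpos : ∀ x, γ x ≠ 0 → 0 < γ x := fun x hx => lt_of_le_of_ne (h.2.1 x) (Ne.symm hx)
  by_cases hle : ∀ x, γ x ≤ (p : ℚ)⁻¹
  · -- `[p]` is a prefix of `exps γ`, and at least two entries are `≤ M`
    obtain ⟨es, hes⟩ : ∃ es, exps γ = (p : ℚ) :: es := by
      obtain ⟨t, ht⟩ := replicate_prefix_of_forall_le hord h hle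
      rw [← hτ, Finset.card_singleton, List.replicate_one] at ht
      exact ⟨t, ht.symm⟩
    have hcount := succ_card_le_countP_exps_of_isDeltaPrepared hord hτ hFS hprep hδ h hle
    rw [Finset.card_singleton, hpδ, hes, List.countP_cons_of_pos (by simpa using hpM.le)] at hcount
    rw [hes] at hsorted
    obtain ⟨e₂, es', rfl⟩ : ∃ e₂ es', es = e₂ :: es' := by
      cases es with
      | nil => simp at hcount
      | cons e₂ es' => exact ⟨e₂, es', rfl⟩
    have hs₂ : (e₂ :: es').Pairwise (· ≤ ·) := (List.pairwise_cons.1 hsorted).2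
    have he₂ : e₂ ≤ M := head_le_of_countP_pos hs₂ (by omega)
    rw [hes]
    by_cases heq₂ : e₂ = M
    swap
    · exact not_lt_triple_of_snd_lt (lt_of_le_of_ne he₂ heq₂)
    rw [heq₂] at hes hs₂ ⊢
    -- exactly one entry of `exps γ` is `≤ p`: the variable `x₀` of weight `1/p`
    have hes' : ∀ x ∈ es', M ≤ x := (List.pairwise_cons.1 hs₂).1
    have hcountp : (exps γ).countP (fun x => decide (x ≤ (p : ℚ))) = 1 := by
      rw [hes, List.countP_cons_of_pos (by simp), List.countP_cons_of_neg (by simpa using hpM),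
        List.countP_eq_zero.2 (fun x hx => by simpa using hpM.trans_le (hes' x hx))]
    rw [countP_exps] at hcountp
    obtain ⟨x₀, hx₀⟩ := Finset.card_eq_one.1 hcountp
    have hx₀' : γ x₀ ≠ 0 ∧ (γ x₀)⁻¹ ≤ (p : ℚ) := by
      have : x₀ ∈ ({x₀} : Finset (Fin N)) := Finset.mem_singleton_self x₀
      rw [← hx₀, Finset.mem_filter] at this
      exact this.2
    have hγx₀ : γ x₀ = (p : ℚ)⁻¹ :=
      le_antisymm (hle x₀) (inv_le_of_inv_le₀ (hγpos x₀ hx₀'.1) hx₀'.2)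
    have hothers : ∀ x, x ≠ x₀ → γ x ≤ M⁻¹ := by
      intro x hx
      by_cases h0 : γ x = 0
      · rw [h0]; exact inv_nonneg.2 hM0.le
      have hnot : ¬ (γ x)⁻¹ ≤ (p : ℚ) := by
        intro hle'
        apply hx
        have : x ∈ ({x₀} : Finset (Fin N)) := by
          rw [← hx₀, Finset.mem_filter]; exact ⟨Finset.mem_univ _, h0, hle'⟩
        exact Finset.mem_singleton.1 this
      have hmem := inv_mem_exps_of_ne_zero h0
      rw [hes, List.mem_cons] at hmem
      rcases hmem with heq | hmem
      · exact absurd heq.le hnot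
      · exact le_inv_of_le_inv₀ hM0 (le_of_mem_of_pairwise hs₂ hmem)
    -- move `x₀` to `i` and count the variables of weight exactly `1/M`
    set π : Equiv.Perm (Fin N) := Equiv.swap i x₀ with hπ
    have h' := h.perm π
    have hπi : π i = x₀ := Equiv.swap_apply_left i x₀
    have hπne : ∀ x, x ≠ i → π x ≠ x₀ := by
      intro x hx heq
      apply hx
      apply π.injective
      rw [heq, hπi]
    have hγS : ∀ x ∈ ({i} : Finset (Fin N)), (γ ∘ π) x = (p : ℚ)⁻¹ := by
      intro x hx
      rw [Finset.mem_singleton] at hx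
      rw [hx, Function.comp_apply, hπi, hγx₀]
    have hγle : ∀ x ∉ ({i} : Finset (Fin N)), (γ ∘ π) x ≤ ((p : ℚ) * (M / p))⁻¹ := by
      intro x hx
      rw [Finset.mem_singleton] at hx
      rw [hpδ, Function.comp_apply]
      exact hothers _ (hπne x hx)
    have hbound := hironakaTau_deltaInitial_le_of_forall_natCast_ne hord hτ hFS hprep hδ hδint h' hγS hγle
    rw [hτδ, Finset.card_singleton, hpδ] at hbound
    have hcnt : 3 ≤ (exps (γ ∘ π)).countP (fun x => decide (x ≤ M)) := by
      rw [countP_exps]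
      exact hbound.trans (one_add_card_le_card_filter hpq hpM.le hM0
        (by rw [Function.comp_apply, hπi, hγx₀]))
    rw [exps_comp_perm, hes, List.countP_cons_of_pos (by simpa using hpM.le),
      List.countP_cons_of_pos (by simp)] at hcnt
    cases es' with
    | nil => simp at hcnt
    | cons e₃ es'' =>
      have hs₃ : (e₃ :: es'').Pairwise (· ≤ ·) := (List.pairwise_cons.1 hs₂).2
      exact not_lt_triple_of_third_le (head_le_of_countP_pos hs₃ (by omega))
  · -- some weight exceeds `1/p`: then the head of `exps γ` is `< p`
    push Not at hle
    obtain ⟨x, hx⟩ := hle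
    have hγx : γ x ≠ 0 := (lt_trans (inv_pos.2 hpq) hx).ne'
    have hlt : (γ x)⁻¹ < p := inv_lt_of_inv_lt₀ hpq hx
    have hmem := inv_mem_exps_of_ne_zero hγx
    obtain ⟨e, es, hes⟩ : ∃ e es, exps γ = e :: es := by
      cases hq : exps γ with
      | nil => rw [hq] at hmem; simp at hmem
      | cons e es => exact ⟨e, es, rfl⟩
    rw [hes] at hmem hsorted ⊢
    have he : e < p := (le_of_mem_of_pairwise hsorted hmem).trans_lt hlt
    rw [ATW.TruncLex.cons_lt_cons]
    rintro (h1 | ⟨h2, -⟩)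
    · exact lt_asymm he h1
    · exact he.ne' h2

end Max

/-! ## §6 The weighted step: reproduction at `b_i = b_j = 0`, drop elsewhere -/

section Step

variable {i j l : Fin N} {p m : ℕ}

/-- Reduced integer weights of the centre `(X_i^p, X_j^{m+1}, X_l^{m+1})` when `gcd(p, m+1) = 1`:
`m+1` on `X_i`, `p` on `X_j, X_l`, `0` on spectators; `ℓ = p(m+1)`. [cite: AbramovichQuekSchober2025, Def. 4.1] -/
def umbrellaStepWeights (i j l : Fin N) (p m : ℕ) : Fin N → ℕ := fun x =>
  if x = i then m + 1 else if x = j ∨ x = l then p else 0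

/-- A weighted-homogeneous polynomial of weight exactly `ℓ` is its own transform on the cobordant chart, with the
exceptional variable absent. (derived here) [cite: AbramovichQuekSchober2025, Def. 4.5 (proper transform on B)] -/
theorem cobordantTransform_eq_rename_some {σ : Type*} {K : Type*} [CommRing K] (w : σ → ℕ) (ℓ : ℕ)
    (F : MvPolynomial σ K) (h : ∀ d ∈ F.support, (d.sum fun x n => w x * n) = ℓ) :
    cobordantTransform w ℓ F = rename some F := by
  classical
  unfold cobordantTransform
  conv_rhs => rw [F.as_sum, map_sum]
  refine Finset.sum_congr rfl fun d hd => ?_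
  rw [rename_monomial, cobordantExponent, h d hd, Nat.sub_self, Finsupp.single_zero, add_zero]

/-- The umbrella is weighted-homogeneous of weight `p(m+1)` for its reduced weights (plumbing). [folklore] -/
private theorem weight_eq_of_mem_support_umbrella (hij : i ≠ j) (hil : i ≠ l) (hjl : j ≠ l) {d : Fin N →₀ ℕ}
    (hd : d ∈ (umbrella k i j l p m).support) :
    (d.sum fun x n => umbrellaStepWeights i j l p m x * n) = p * (m + 1) := by
  rcases mem_pair_of_mem_support_umbrella hd with rfl | rfl
  · rw [Finsupp.sum_single_index (by simp)]
    simp [umbrellaStepWeights, mul_comm]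
  · rw [umbExp, Finsupp.sum_add_index' (by simp) (by intros; simp [mul_add]),
      Finsupp.sum_single_index (by simp), Finsupp.sum_single_index (by simp)]
    simp [umbrellaStepWeights, hij.symm, hil.symm, hjl]
    ring

/-- **The step germ of the umbrella** at the point `b` of the exceptional divisor of `B₊`:
`(X_i' + b_i)^p + (X_j' + b_j)^m (X_l' + b_l)` (primed variables = `Fin.succ`, index `0` = the exceptional
variable, which is absent). (derived here) [cite: AbramovichQuekSchober2025, Def. 4.5 / Construction 4.2] -/
theorem stepGerm_umbrella (hij : i ≠ j) (hil : i ≠ l) (hjl : j ≠ l) (b : Option (Fin N) → k) :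
    stepGerm (umbrellaStepWeights i j l p m) (p * (m + 1)) b (umbrella k i j l p m) =
      (X i.succ + C (b (some i))) ^ p + (X j.succ + C (b (some j))) ^ m * (X l.succ + C (b (some l))) := by
  rw [stepGerm, pointPolynomial, cobordantTransform_eq_rename_some _ _ _
    (fun d hd => weight_eq_of_mem_support_umbrella hij hil hjl hd), translate_rename_some, rename_rename]
  simp [PointBlowup.translate, umbrella, Function.comp_def, finSuccEquiv_symm_some]

/-- **STALL.** Characteristic `p`, `m = p·e`, `e ≥ 1`: at every point `b` of the exceptional divisor with
`b_i = b_j = 0` and `b_l = c^p` a `p`-th power, the step germ is the umbrella `X_i'^p + X_j'^{pe} X_l'` in the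
regular system of parameters `X_i' ↦ X_i' + c X_j'^e`, so its invariant is `(p, pe+1, pe+1)` AGAIN. (derived here)
[cite: Temkin2025, §1.2.2 warning (1) (p = 2: the invariant (2,3,3) persists)] [cite: AbramovichTemkinWlodarczyk2024,
Thm 5.3.1 (characteristic zero: the invariant drops)] -/
theorem stepStalls_umbrella (hij : i ≠ j) (hil : i ≠ l) (hjl : j ≠ l) [hp : Fact p.Prime] [CharP k p] {e : ℕ}
    (he : 0 < e) (b : Option (Fin N) → k) (hbi : b (some i) = 0) (hbj : b (some j) = 0) {c : k}
    (hbl : b (some l) = c ^ p) :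
    StepStalls [(p : ℚ), ((p * e + 1 : ℕ) : ℚ), ((p * e + 1 : ℕ) : ℚ)]
      (admissibleInvariants
        (stepGerm (umbrellaStepWeights i j l p (p * e)) (p * (p * e + 1)) b (umbrella k i j l p (p * e)))) := by
  have hprime := hp.out
  have hij' : i.succ ≠ j.succ := fun h => hij (Fin.succ_injective _ h)
  have hil' : i.succ ≠ l.succ := fun h => hil (Fin.succ_injective _ h)
  have hjl' : j.succ ≠ l.succ := fun h => hjl (Fin.succ_injective _ h)
  have key : stepGerm (umbrellaStepWeights i j l p (p * e)) (p * (p * e + 1)) b (umbrella k i j l p (p * e)) =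
      addMonomialShear i.succ j.succ (Ne.symm hij') c e (umbrella k i.succ j.succ l.succ p (p * e)) := by
    rw [stepGerm_umbrella hij hil hjl, hbi, hbj, hbl, umbrella]
    simp only [map_add, map_pow, map_mul, map_zero, add_zero]
    rw [addMonomialShear_X_self, addMonomialShear_X_of_ne _ _ _ _ _ (Ne.symm hij'),
      addMonomialShear_X_of_ne _ _ _ _ _ (Ne.symm hil'), add_pow_char]
    ring
  change IsMaxInv _ _
  rw [key, admissibleInvariants_map_eq _ (fun x => constantCoeff_addMonomialShear_X _ _ _ _ he.ne' x)]
  refine isMaxInv_umbrella hij' hil' hjl' hprime.two_le (Nat.le_mul_of_pos_right p he) ?_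
  rw [Nat.dvd_add_right (dvd_mul_right p e)]
  exact fun h1 => hprime.one_lt.ne' (Nat.dvd_one.1 h1)

/-- Over `𝔽_p` every element is a `p`-th power, so the stall happens at EVERY rational point with
`b_i = b_j = 0` (one torus class). (derived here) [cite: Temkin2025, §1.2.2 warning (1)] -/
theorem stepStalls_umbrella_zmod {i j l : Fin N} (hij : i ≠ j) (hil : i ≠ l) (hjl : j ≠ l) {p : ℕ}
    [hp : Fact p.Prime] {e : ℕ} (he : 0 < e) (b : Option (Fin N) → ZMod p) (hbi : b (some i) = 0)
    (hbj : b (some j) = 0) :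
    StepStalls [(p : ℚ), ((p * e + 1 : ℕ) : ℚ), ((p * e + 1 : ℕ) : ℚ)]
      (admissibleInvariants
        (stepGerm (umbrellaStepWeights i j l p (p * e)) (p * (p * e + 1)) b
          (umbrella (ZMod p) i j l p (p * e)))) :=
  stepStalls_umbrella hij hil hjl he b hbi hbj (ZMod.pow_card (b (some l))).symm

/-- **DROP.** At every point of the exceptional divisor with `b_i ≠ 0` or `b_j ≠ 0` the new germ has order
`≤ 1 < p` (any characteristic, any `m ≥ 1`, `p ≥ 2`), so every invariant of it is below `(p, …)`. (derived here)
[cite: AbramovichTemkinWlodarczyk2024, Lemma 5.2.7 and Thm 5.3.1] -/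
theorem stepDrops_umbrella_of_ne (hij : i ≠ j) (hil : i ≠ l) (hjl : j ≠ l) (hp : 2 ≤ p) (hm : m ≠ 0)
    (b : Option (Fin N) → k) (hb : b (some i) ≠ 0 ∨ b (some j) ≠ 0) (as : List ℚ) :
    StepDrops ((p : ℚ) :: as)
      (admissibleInvariants (stepGerm (umbrellaStepWeights i j l p m) (p * (m + 1)) b (umbrella k i j l p m))) := by
  have hil' : i.succ ≠ l.succ := fun h => hil (Fin.succ_injective _ h)
  have hjl' : j.succ ≠ l.succ := fun h => hjl (Fin.succ_injective _ h)
  apply stepDrops_of_monomialOrd_lt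
  rw [stepGerm_umbrella hij hil hjl]
  set G : MvPolynomial (Fin (N + 1)) k :=
    (X i.succ + C (b (some i))) ^ p + (X j.succ + C (b (some j))) ^ m * (X l.succ + C (b (some l))) with hG
  have hp1 : ((1 : ℕ) : ℕ∞) < (p : ℕ∞) := by exact_mod_cast hp
  by_cases hbj : b (some j) = 0
  · -- `b_j = 0`, `b_i ≠ 0`: the constant term `b_i^p` is non-zero
    have hbi : b (some i) ≠ 0 := hb.resolve_right (fun h => h hbj)
    have hc : constantCoeff G ≠ 0 := by
      simp [hG, constantCoeff_X, hbj, zero_pow hm, hbi]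
    rw [monomialOrd_eq_zero_of_constantCoeff_ne_zero _ hc]
    exact_mod_cast (by omega : 0 < p)
  · -- `b_j ≠ 0`: the coefficient of `X_l'` is `b_j^m ≠ 0`, read through `∂/∂X_l'`
    have hD : pderiv l.succ G = (X j.succ + C (b (some j))) ^ m := by
      simp [hG, Derivation.leibniz, pderiv_X_of_ne hil', pderiv_X_of_ne hjl']
    have hc : constantCoeff (pderiv l.succ G) ≠ 0 := by
      rw [hD]
      simp [constantCoeff_X, hbj]
    have h1 := monomialOrd_le_pderiv_add (fun _ => 1) G l.succ
    rw [monomialOrd_eq_zero_of_constantCoeff_ne_zero _ hc, zero_add] at h1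
    exact h1.trans_lt hp1

/-- **The dichotomy over `𝔽_p`** for `v^p + w^{pe} u`: at a rational point `b` of the exceptional divisor of
the step the value `(p, pe+1, pe+1)` is KEPT iff `b_v = b_w = 0` (one torus class), and DROPS otherwise.
(derived here) [cite: Temkin2025, §1.2.2 warning (1)] [cite: AbramovichTemkinWlodarczyk2024, Thm 5.3.1] -/
theorem step_umbrella_dichotomy_zmod {i j l : Fin N} (hij : i ≠ j) (hil : i ≠ l) (hjl : j ≠ l) {p : ℕ}
    [hp : Fact p.Prime] {e : ℕ} (he : 0 < e) (b : Option (Fin N) → ZMod p) :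
    (b (some i) = 0 ∧ b (some j) = 0 →
      StepStalls [(p : ℚ), ((p * e + 1 : ℕ) : ℚ), ((p * e + 1 : ℕ) : ℚ)]
        (admissibleInvariants
          (stepGerm (umbrellaStepWeights i j l p (p * e)) (p * (p * e + 1)) b
            (umbrella (ZMod p) i j l p (p * e))))) ∧
    (¬ (b (some i) = 0 ∧ b (some j) = 0) →
      StepDrops [(p : ℚ), ((p * e + 1 : ℕ) : ℚ), ((p * e + 1 : ℕ) : ℚ)]
        (admissibleInvariants
          (stepGerm (umbrellaStepWeights i j l p (p * e)) (p * (p * e + 1)) b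
            (umbrella (ZMod p) i j l p (p * e))))) := by
  refine ⟨fun h => stepStalls_umbrella_zmod hij hil hjl he b h.1 h.2, fun h => ?_⟩
  have hb : b (some i) ≠ 0 ∨ b (some j) ≠ 0 := by
    by_contra hc
    push Not at hc
    exact h hc
  have hpe : p * e ≠ 0 := Nat.mul_ne_zero hp.out.ne_zero he.ne'
  exact stepDrops_umbrella_of_ne hij hil hjl hp.out.two_le hpe b hb _

end Step

end WeightedBlowup

end Literature.AlgebraicGeometry.Resolution

end
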